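import Summits.Ventures.Crystal3D.Theorems.StickyWulffConstantCoaxialWallLawSkewRoots
import Summits.Ventures.Crystal3D.Theorems.StickyWulffConstantCoaxialWallLawForeignTilt
import Summits.Ventures.Crystal3D.Theorems.StickyWulffConstantGenericWallFloorStackWalkStarExclusion
import Summits.Ventures.Crystal3D.Theorems.StickyWulffConstantGenericWallFloorStackLedgerLocalTools
import Summits.Ventures.Crystal3D.Theorems.StickyWulffConstantCoaxialWallLawInPlaneStackWalkers
import HarnessLib

/-!
# Every menu normal is the axis of a frame of the same lattice — the `∃ L` packaging of lane F's stub
# (crux `CoaxialWallLaw`, stmt-Ventures-19481, line `WallLedgerF`)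

HONEST FRAMING. Venture `Summits/Ventures/Crystal3D` (cell `crystal3d-full`), helper `--supports` the crux `CoaxialWallLaw`
of `route-Ventures-StickyWulffConstant` (REGISTERED line `WallLedgerF`, open stub `stub_coaxialTwoSlabAdhesion`).  Infrastructure
only; rung credit; F-C1 not moved; NOT the stub.

The stub's conclusion lets the DEFENDER pick the shared Barlow frame `L` (charge `½·√(1 − ⟪L e₃, e₃⟫²)`), but the cell
inequalities landed so far (`TwoSlabLedgerAt q A₁ t₁ A₂ t₂`, lanes G/F) speak of a menu normal `m` of grain 1 (the twin axis,
the basal axis).  To turn one into the other one needs a frame `L` of the SAME lattice with `L e₃ = m`: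

* **`exists_frame_of_menu`** — for every linear isometry `A` and every unit MENU normal `m` of `A` (`⟪A w, m⟫ ∈ {0, ±√(2/3)}`
  on the twelve slots) there is a linear isometry `L` with `L '' Λ₀ = A '' Λ₀` and `L e₃ = m` (cubic coordinates of `A⁻¹m`
  are `(±1, ±1, ±1)/√3`, `menu_cubic_coords_pm_one`; the lattice symmetry of that cube vertex, `exists_latticeFrame_of_cube`;
  central inversion for the sign);
* `movedFcc_subset_frame` / `twin_image_eq_frame_negConst` — the two containments of the co-axiality clause for such an `L`
  (`A·Λ₀ + t ⊆ L·B(+1) + t`; a twin about `m` is `L·B(−1)`);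
* **`coaxialStub_of_twoSlabLedgerAt_frame`** — `TwoSlabLedgerAt q A₁ t₁ A₂ t₂`, a frame `L` presenting both grains as Barlow
  stackings, and `½·√(1 − ⟪L e₃, e₃⟫²) ≤ q` give the conclusion of `stub_coaxialTwoSlabAdhesion` for the pair VERBATIM.
WHAT THIS IS NOT: not the stub; F-C1 not moved.
-/

noncomputable section

namespace Summit.Ventures.Crystal3D.Theorems

open Summit.Ventures.Crystal3D Finset NearIdentity
open Literature.MathematicalPhysics.StatisticalMechanics (fccStacking barlowStacking IsHaggSeq contactDeficiency
  constHagg isHaggSeq_const)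
open scoped InnerProductSpace

/-- Central inversion preserves `Λ₀`. -/
theorem neg_image_fcc :
    (LinearIsometryEquiv.neg ℝ : EuclideanSpace ℝ (Fin 3) ≃ₗᵢ[ℝ] EuclideanSpace ℝ (Fin 3)) ''
      fccStacking 1 (Real.sqrt (2 / 3)) = fccStacking 1 (Real.sqrt (2 / 3)) := by
  ext p
  simp only [Set.mem_image, LinearIsometryEquiv.coe_neg]
  constructor
  · rintro ⟨q, hq, rfl⟩; exact fcc_neg_mem hq
  · intro hp; exact ⟨-p, fcc_neg_mem hp, neg_neg p⟩

/-- **Every unit menu normal of a grain is the axis of a frame of the same lattice.** -/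
theorem exists_frame_of_menu (A : EuclideanSpace ℝ (Fin 3) ≃ₗᵢ[ℝ] EuclideanSpace ℝ (Fin 3))
    {m : EuclideanSpace ℝ (Fin 3)} (hm : ‖m‖ = 1)
    (hmenu : ∀ w ∈ fccSlots, ⟪A w, m⟫_ℝ = 0 ∨ ⟪A w, m⟫_ℝ = Real.sqrt (2 / 3) ∨ ⟪A w, m⟫_ℝ = -Real.sqrt (2 / 3)) :
    ∃ L : EuclideanSpace ℝ (Fin 3) ≃ₗᵢ[ℝ] EuclideanSpace ℝ (Fin 3),
      L '' fccStacking 1 (Real.sqrt (2 / 3)) = A '' fccStacking 1 (Real.sqrt (2 / 3)) ∧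
      L (EuclideanSpace.single (2 : Fin 3) (1 : ℝ)) = m := by
  set μ : EuclideanSpace ℝ (Fin 3) := A.symm m with hμ
  have hμ1 : ‖μ‖ = 1 := by rw [hμ, LinearIsometryEquiv.norm_map, hm]
  have hAμ : A μ = m := by rw [hμ, LinearIsometryEquiv.apply_symm_apply]
  have hmenuμ : ∀ w ∈ fccSlots, ⟪(LinearIsometryEquiv.refl ℝ (EuclideanSpace ℝ (Fin 3))) w, μ⟫_ℝ = 0 ∨
      ⟪(LinearIsometryEquiv.refl ℝ (EuclideanSpace ℝ (Fin 3))) w, μ⟫_ℝ = Real.sqrt (2 / 3) ∨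
      ⟪(LinearIsometryEquiv.refl ℝ (EuclideanSpace ℝ (Fin 3))) w, μ⟫_ℝ = -Real.sqrt (2 / 3) := by
    intro w hw
    rw [LinearIsometryEquiv.coe_refl, id, hμ, ← A.inner_map_map, LinearIsometryEquiv.apply_symm_apply]
    exact hmenu w hw
  obtain ⟨k, hk, hkj⟩ := menu_cubic_coords_pm_one (LinearIsometryEquiv.refl ℝ _) hμ1 hmenuμ
  have h3 : (0 : ℝ) < Real.sqrt 3 := Real.sqrt_pos.2 (by norm_num)
  have h33 : Real.sqrt 3 ^ 2 = 3 := Real.sq_sqrt (by norm_num)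
  have hcμ : ∀ j, cubicCoords μ j = (k j : ℝ) / Real.sqrt 3 := by
    intro j
    have h := hkj j
    rw [LinearIsometryEquiv.coe_refl, id, real_inner_comm, inner_cubicFrame] at h
    field_simp; linarith
  have hkR : ∀ j, (k j : ℝ) = 1 ∨ (k j : ℝ) = -1 := by
    intro j; rcases hk j with h | h <;> rw [h] <;> norm_num
  obtain ⟨c, hc0, hc1, hc2⟩ := exists_cubeInt_eq _ _ _ (hkR 0) (hkR 1) (hkR 2)
  have hc : ∀ j, (cubeInt c j : ℝ) = k j := by
    intro j; fin_cases j
    · exact hc0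
    · exact hc1
    · exact hc2
  obtain ⟨G, hGΛ, κ, hκ, hG⟩ := exists_latticeFrame_of_cube c
  -- `κ = ± 1/√3` from `‖G e₃‖ = 1`
  have hk2 : ∀ j, ((k j : ℝ)) ^ 2 = 1 := by
    intro j; rcases hk j with h | h <;> rw [h] <;> norm_num
  have hnorm : ∑ j : Fin 3, (κ * (cubeInt c j : ℝ)) ^ 2 = 1 := by
    have h := norm_sq_eq_cubicCoords (G (EuclideanSpace.single (2 : Fin 3) (1 : ℝ)))
    rw [LinearIsometryEquiv.norm_map, PiLp.norm_single, norm_one, one_pow] at h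
    rw [h]
    simp only [dotProduct]
    exact Finset.sum_congr rfl fun j _ => by rw [hG j, sq]
  have hκ2 : κ ^ 2 = 1 / 3 := by
    simp only [Fin.sum_univ_three, mul_pow] at hnorm
    rw [hc 0, hc 1, hc 2, hk2 0, hk2 1, hk2 2] at hnorm
    linarith
  have hκ' : κ = 1 / Real.sqrt 3 ∨ κ = -(1 / Real.sqrt 3) := by
    have : (κ - 1 / Real.sqrt 3) * (κ + 1 / Real.sqrt 3) = 0 := by
      have e : (κ - 1 / Real.sqrt 3) * (κ + 1 / Real.sqrt 3) = κ ^ 2 - 1 / Real.sqrt 3 ^ 2 := by ring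
      rw [e, hκ2, h33]; ring
    rcases mul_eq_zero.1 this with h | h
    · exact Or.inl (by linarith)
    · exact Or.inr (by linarith)
  rcases hκ' with hκ' | hκ'
  · -- `G e₃ = μ`
    have hGe : G (EuclideanSpace.single (2 : Fin 3) (1 : ℝ)) = μ :=
      cubicCoords_injective (funext fun j => by rw [hG j, hc j, hcμ j, hκ']; ring)
    refine ⟨G.trans A, ?_, ?_⟩
    · rw [LinearIsometryEquiv.coe_trans, Set.image_comp, hGΛ]
    · rw [LinearIsometryEquiv.coe_trans, Function.comp_apply, hGe, hAμ]
  · -- `G e₃ = -μ`: compose with the central inversion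
    have hGe : G (EuclideanSpace.single (2 : Fin 3) (1 : ℝ)) = -μ := by
      refine cubicCoords_injective (funext fun j => ?_)
      rw [show -μ = (-1 : ℝ) • μ by rw [neg_one_smul], cubicCoords_smul, Pi.smul_apply, smul_eq_mul, hG j, hc j,
        hcμ j, hκ']
      ring
    refine ⟨(G.trans (LinearIsometryEquiv.neg ℝ)).trans A, ?_, ?_⟩
    · rw [LinearIsometryEquiv.coe_trans, Set.image_comp, LinearIsometryEquiv.coe_trans, Set.image_comp, hGΛ,
        neg_image_fcc]
    · rw [LinearIsometryEquiv.coe_trans, Function.comp_apply, LinearIsometryEquiv.coe_trans, Function.comp_apply,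
        hGe, LinearIsometryEquiv.coe_neg]
      simp only [neg_neg, hAμ]


/-- A moved lattice sits inside its own frame's Barlow stacking `B(+1)` (with the same translation). -/
theorem movedFcc_subset_frame {A L : EuclideanSpace ℝ (Fin 3) ≃ₗᵢ[ℝ] EuclideanSpace ℝ (Fin 3)}
    (hL : L '' fccStacking 1 (Real.sqrt (2 / 3)) = A '' fccStacking 1 (Real.sqrt (2 / 3))) (t : EuclideanSpace ℝ (Fin 3)) :
    (fun p => A p + t) '' fccStacking 1 (Real.sqrt (2 / 3)) ⊆
      (fun p => L p + t) '' barlowStacking 1 (Real.sqrt (2 / 3)) constHagg := by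
  rintro _ ⟨p, hp, rfl⟩
  have : A p ∈ L '' fccStacking 1 (Real.sqrt (2 / 3)) := by rw [hL]; exact ⟨p, hp, rfl⟩
  obtain ⟨q, hq, hqp⟩ := this
  exact ⟨q, hq, by simp only [hqp]⟩

/-- A lattice equal to `L·B(−1)` sits inside `L·B(−1) + t`. -/
theorem movedFcc_subset_frame_negConst {A L : EuclideanSpace ℝ (Fin 3) ≃ₗᵢ[ℝ] EuclideanSpace ℝ (Fin 3)}
    (hL : A '' fccStacking 1 (Real.sqrt (2 / 3)) = L '' barlowStacking 1 (Real.sqrt (2 / 3)) (fun _ : ℤ => (-1 : ℤ)))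
    (t : EuclideanSpace ℝ (Fin 3)) :
    (fun p => A p + t) '' fccStacking 1 (Real.sqrt (2 / 3)) ⊆
      (fun p => L p + t) '' barlowStacking 1 (Real.sqrt (2 / 3)) (fun _ : ℤ => (-1 : ℤ)) := by
  rintro _ ⟨p, hp, rfl⟩
  have : A p ∈ L '' barlowStacking 1 (Real.sqrt (2 / 3)) (fun _ : ℤ => (-1 : ℤ)) := by rw [← hL]; exact ⟨p, hp, rfl⟩
  obtain ⟨q, hq, hqp⟩ := this
  exact ⟨q, hq, by simp only [hqp]⟩

/-- **A twin about the frame's axis is the frame's `B(−1)`.**  If `L '' Λ₀ = A₁ '' Λ₀`, `L e₃ = m` and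
`A₂ '' Λ₀ = twinFrame A₁ m '' Λ₀`, then `A₂ '' Λ₀ = L '' B(−1)`. -/
theorem twin_image_eq_frame_negConst {A₁ A₂ L : EuclideanSpace ℝ (Fin 3) ≃ₗᵢ[ℝ] EuclideanSpace ℝ (Fin 3)}
    {m : EuclideanSpace ℝ (Fin 3)} (hm : ‖m‖ = 1)
    (hL : L '' fccStacking 1 (Real.sqrt (2 / 3)) = A₁ '' fccStacking 1 (Real.sqrt (2 / 3)))
    (hLe : L (EuclideanSpace.single (2 : Fin 3) (1 : ℝ)) = m)
    (hA₂ : A₂ '' fccStacking 1 (Real.sqrt (2 / 3)) = twinFrame A₁ m '' fccStacking 1 (Real.sqrt (2 / 3))) :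
    A₂ '' fccStacking 1 (Real.sqrt (2 / 3)) = L '' barlowStacking 1 (Real.sqrt (2 / 3)) (fun _ : ℤ => (-1 : ℤ)) := by
  rw [hA₂, image_twinFrame_eq A₁ hm, image_negConst_eq_reflection_image L, hLe, hL]

/-- The isometry's `e₃`-`e₃` inner product is at most `1` in square. -/
theorem sqrt_one_sub_inner_sq_le_one (v : EuclideanSpace ℝ (Fin 3)) :
    Real.sqrt (1 - ⟪v, EuclideanSpace.single (2 : Fin 3) (1 : ℝ)⟫_ℝ ^ 2) ≤ 1 := by
  rw [show (1 : ℝ) = Real.sqrt 1 from Real.sqrt_one.symm]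
  exact Real.sqrt_le_sqrt (by rw [Real.sqrt_one]; nlinarith [sq_nonneg ⟪v, EuclideanSpace.single (2 : Fin 3) (1 : ℝ)⟫_ℝ])

/-- **The stub's conclusion for one pair from a cell inequality and a presenting frame.**  If `TwoSlabLedgerAt q A₁ t₁ A₂ t₂`,
the frame `L` presents both grains (`Aᵢ·Λ₀ + tᵢ ⊆ L·B(σᵢ) + sᵢ`, `σᵢ` Hägg) and lane F's charge in that frame is at most `q`,
then the conclusion of `stub_coaxialTwoSlabAdhesion` holds for the pair, with THIS frame. -/
theorem coaxialStub_of_twoSlabLedgerAt_frame {q : ℝ}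
    {A₁ : EuclideanSpace ℝ (Fin 3) ≃ₗᵢ[ℝ] EuclideanSpace ℝ (Fin 3)} {t₁ : EuclideanSpace ℝ (Fin 3)}
    {A₂ : EuclideanSpace ℝ (Fin 3) ≃ₗᵢ[ℝ] EuclideanSpace ℝ (Fin 3)} {t₂ : EuclideanSpace ℝ (Fin 3)}
    (hcell : TwoSlabLedgerAt q A₁ t₁ A₂ t₂)
    (L : EuclideanSpace ℝ (Fin 3) ≃ₗᵢ[ℝ] EuclideanSpace ℝ (Fin 3)) (s₁ s₂ : EuclideanSpace ℝ (Fin 3)) {σ σ' : ℤ → ℤ}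
    (hσ : IsHaggSeq σ) (hσ' : IsHaggSeq σ')
    (hsub₁ : (fun p => A₁ p + t₁) '' fccStacking 1 (Real.sqrt (2 / 3)) ⊆
      (fun p => L p + s₁) '' barlowStacking 1 (Real.sqrt (2 / 3)) σ)
    (hsub₂ : (fun p => A₂ p + t₂) '' fccStacking 1 (Real.sqrt (2 / 3)) ⊆
      (fun p => L p + s₂) '' barlowStacking 1 (Real.sqrt (2 / 3)) σ')
    (hq : (1 / 2 : ℝ) * Real.sqrt (1 - ⟪L (EuclideanSpace.single (2 : Fin 3) (1 : ℝ)),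
      (EuclideanSpace.single (2 : Fin 3) (1 : ℝ))⟫_ℝ ^ 2) ≤ q) :
    ∃ (L : EuclideanSpace ℝ (Fin 3) ≃ₗᵢ[ℝ] EuclideanSpace ℝ (Fin 3))
        (s₁ s₂ : EuclideanSpace ℝ (Fin 3)) (σ σ' : ℤ → ℤ), IsHaggSeq σ ∧ IsHaggSeq σ' ∧
        (fun p => A₁ p + t₁) '' fccStacking 1 (Real.sqrt (2 / 3)) ⊆
          (fun p => L p + s₁) '' barlowStacking 1 (Real.sqrt (2 / 3)) σ ∧
        (fun p => A₂ p + t₂) '' fccStacking 1 (Real.sqrt (2 / 3)) ⊆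
          (fun p => L p + s₂) '' barlowStacking 1 (Real.sqrt (2 / 3)) σ' ∧
    ∃ C R₀ : ℝ, 1 ≤ R₀ ∧ ∀ h : ℝ, 0 ≤ h → ∀ ρ : ℝ, R₀ ≤ ρ →
      ∀ X P₁ P₂ : Finset (EuclideanSpace ℝ (Fin 3)),
      (∀ p ∈ X, ∀ q ∈ X, p ≠ q → 1 ≤ dist p q) → P₁ ⊆ X → P₂ ⊆ X \ P₁ →
      (∀ p ∈ X, -(2 * R₀) ≤ p 2 ∧ p 2 ≤ h + 2 * R₀ ∧ p 0 ^ 2 + p 1 ^ 2 ≤ ρ ^ 2) →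
      (∀ p, p ∈ P₁ ↔ (p ∈ (fun q => A₁ q + t₁) '' fccStacking 1 (Real.sqrt (2 / 3)) ∧
        -(2 * R₀) ≤ p 2 ∧ p 2 ≤ -R₀ ∧ p 0 ^ 2 + p 1 ^ 2 ≤ ρ ^ 2)) →
      (∀ p, p ∈ P₂ ↔ (p ∈ (fun q => A₂ q + t₂) '' fccStacking 1 (Real.sqrt (2 / 3)) ∧
        h + R₀ ≤ p 2 ∧ p 2 ≤ h + 2 * R₀ ∧ p 0 ^ 2 + p 1 ^ 2 ≤ ρ ^ 2)) →
      ((((P₁ ×ˢ (X \ P₁)).filter fun pq => dist pq.1 pq.2 = 1).card : ℕ) : ℝ) +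
        ((((P₂ ×ˢ ((X \ P₁) \ P₂)).filter fun pq => dist pq.1 pq.2 = 1).card : ℕ) : ℝ) ≤
        contactDeficiency ((X \ P₁) \ P₂) +
          (Real.sqrt 2 / 4 * ∑ᶠ w ∈ {w ∈ fccStacking 1 (Real.sqrt (2 / 3)) | ‖w‖ = 1},
              |⟪w, A₁.symm (EuclideanSpace.single (2 : Fin 3) (1 : ℝ))⟫_ℝ| +
            Real.sqrt 2 / 4 * ∑ᶠ w ∈ {w ∈ fccStacking 1 (Real.sqrt (2 / 3)) | ‖w‖ = 1},
              |⟪w, A₂.symm (EuclideanSpace.single (2 : Fin 3) (1 : ℝ))⟫_ℝ| -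
            (1 / 2 : ℝ) * Real.sqrt (1 - ⟪L (EuclideanSpace.single (2 : Fin 3) (1 : ℝ)),
              (EuclideanSpace.single (2 : Fin 3) (1 : ℝ))⟫_ℝ ^ 2)) * Real.pi * ρ ^ 2 +
          C * (1 + h) * ρ :=
  ⟨L, s₁, s₂, σ, σ', hσ, hσ', hsub₁, hsub₂, twoSlabLedgerAt_mono hq hcell⟩

end Summit.Ventures.Crystal3D.Theorems

end
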